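import Literature.AlgebraicTopology.FundamentalGroup.PlanarLassos
import Literature.AlgebraicTopology.FundamentalGroup.VanKampenPushout
import HarnessLib

/-!
# The fundamental group of a punctured planar domain is normally generated by lassos

Topic `Literature/AlgebraicTopology/FundamentalGroup`.  For `C ⊆ ℂ` convex open, `F ⊆ C` finite
and `x ∈ C ∖ F`:

* `PlanarLasso.zpowers_loopClass_eq_top` — one puncture: the class of ANY lasso around `a`
  generates `π₁(C ∖ {a}, x)` (Hatcher, Thm. 1.7, through the exponential covering
  `ExpRegion C a → C ∖ {a}` of `FreeGroupPuncturedPlane`, whose total space is simply connected: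
  the lasso lifts to a path from `e` to `2πi + e`, so Mathlib's
  `IsAddQuotientCoveringMap.fundamentalGroupToMulOpposite` — injective — sends its class to the
  generator of the deck group `2πiℤ`);
* `exists_planarLasso` — every puncture carries a lasso at every base point;
* **`normalClosure_lassoClasses_eq_top`** — `π₁(C ∖ F, x)` is the normal closure of the classes
  of the lassos around the points of `F` (all centres in `F`, all radii, all leashes): induction
  on `|F|` by splitting off punctures with a strip, exactly as in `FreeGroupPuncturedPlane`, using
  only the GENERATION half of the Seifert–van Kampen theorem (Hatcher, Lemma 1.15; the tree's
  `VanKampen.closure_range_inclHom_union_eq_top`) and the transport of lassos along inclusions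
  and changes of base point;
* **`normalClosure_eq_top_of_lassos`** — hence ONE lasso per puncture (any choice) normally
  generates, two lassos around the same puncture being conjugate (`PlanarLasso.isConj_loopClass`).

This is the statement "π₁ of the plane minus `n` points is generated by loops going once around
the punctures" (Hatcher, §1.2, discussion after Example 1.21) with explicit loops, complementing
the abstract isomorphism `π₁(C ∖ F) ≅ F(Fin |F|)` of `FreeGroupPuncturedPlane`.  It is the planar
input of the Zariski–van Kampen generation theorem for complements of affine hypersurfaces
(`Literature/AlgebraicGeometry/FundamentalGroup/HypersurfaceComplementMeridians*`).
Everything is proved; no named facts.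

## References

* A. Hatcher, *Algebraic Topology*, CUP (2002), §1.1 Thm. 1.7, §1.2 Lemma 1.15 and Example 1.21
  ff., §1.3 Prop. 1.39. [HatcherAT2002]
* I. Shimada, Int. J. Math. 21 (2010), §3 Prop. 3.4 (lassos). [Shimada2010ZvK]

## Design notes

* `_root_.FundamentalGroup` is written in full (CONVENTIONS.md §2).
* No declaration in this file uses `sorry`.
-/

noncomputable section

open Set Function unitInterval Topology Complex

namespace Literature.AlgebraicTopology.FundamentalGroup

namespace PlanarLasso

variable {a : ℂ}

/-! ### One puncture: the class of any lasso generates `π₁(C ∖ {a}, x)` -/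

section OnePuncture

variable {C : Set ℂ}

/-- The period `2πi`, as an element of the lattice `2πiℤ`. [folklore] -/
def basicPeriod : periods := ⟨2 * Real.pi * Complex.I, AddSubgroup.mem_zmultiples _⟩

/-- `(2πiℤ)ᵐᵒᵖ` (multiplicatively) is generated by `2πi`. [folklore] -/
private theorem zpowers_op_ofAdd_basicPeriod_eq_top :
    Subgroup.zpowers (MulOpposite.op (Multiplicative.ofAdd basicPeriod)) = ⊤ := by
  rw [eq_top_iff]
  rintro g -
  obtain ⟨k, hk⟩ := AddSubgroup.mem_zmultiples_iff.1 (Multiplicative.toAdd (MulOpposite.unop g)).2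
  refine Subgroup.mem_zpowers_iff.2 ⟨k, ?_⟩
  rw [← MulOpposite.op_zpow, ← ofAdd_zsmul]
  have : k • basicPeriod = Multiplicative.toAdd (MulOpposite.unop g) :=
    Subtype.ext (by rw [AddSubgroupClass.coe_zsmul]; exact hk)
  rw [this]
  rfl

/-- **One puncture: the class of ANY lasso around `a` generates `π₁(C ∖ {a}, x)`** for `C ⊆ ℂ`
convex open and `a ∈ C` (Hatcher, Thm. 1.7, through the exponential covering
`ExpRegion C a → C ∖ {a}`, `w ↦ a + eʷ`, of `FreeGroupPuncturedPlane`: its total space is simply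
connected and the lasso lifts to a path from `e` to `2πi + e`, so under Mathlib's
`IsAddQuotientCoveringMap.fundamentalGroupToMulOpposite` — injective — the class of the lasso
goes to the generator `2πi` of the deck group `2πiℤ`). [cite: HatcherAT2002, §1.1 Thm. 1.7 and §1.3 Prop. 1.39] -/
theorem zpowers_loopClass_eq_top (hC : Convex ℝ C) (hCo : IsOpen C) (ha : a ∈ C)
    {x : ↥(C \ {a})} (L : PlanarLasso (C \ {a}) x a) : Subgroup.zpowers L.loopClass = ⊤ := by
  haveI := simplyConnectedSpace_expRegion (hC.starConvex ha) hCo ha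
  have hp := isAddQuotientCoveringMap_expCover (C := C) (a := a) hCo
  haveI : ContinuousConstVAdd periods (ExpRegion C a) := hp.toContinuousConstVAdd
  have cov : IsCoveringMap (expCover C a) := hp.isCoveringMap
  obtain ⟨w₀, hw₀⟩ := surjective_expCover (C := C) (a := a) x
  let e : expCover C a ⁻¹' {x} := ⟨w₀, hw₀⟩
  -- the lift of the leash
  have h0 : L.leash.toContinuousMap 0 = expCover C a w₀ := by rw [hw₀]; exact L.leash.source
  set w₁ := cov.liftPath L.leash.toContinuousMap w₀ h0 1 with hw₁
  let Λ : Path w₀ w₁ :=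
    ⟨cov.liftPath L.leash.toContinuousMap w₀ h0, cov.liftPath_zero _ _ h0, rfl⟩
  have hΛ : ∀ t, expCover C a (Λ t) = L.leash t := fun t =>
    congr_fun (cov.liftPath_lifts L.leash.toContinuousMap w₀ h0) t
  have hexp : Complex.exp (w₁ : ℂ) = L.ε := by
    have h1 := congrArg Subtype.val (hΛ 1)
    rw [L.leash.target, expCover_apply_coe] at h1
    exact add_left_cancel h1
  -- the lift of the circle: the vertical segment from `w₁` to `2πi + w₁`
  have hΩmem : ∀ t : I, (w₁ : ℂ) + 2 * Real.pi * Complex.I * ((t : ℝ) : ℂ) ∈ ExpRegion C a := by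
    intro t
    rw [mem_expRegion, Complex.exp_add, hexp]
    exact (L.circlePt_mem t).1
  let Ω : Path w₁ (basicPeriod +ᵥ w₁) :=
    { toFun := fun t => ⟨(w₁ : ℂ) + 2 * Real.pi * Complex.I * ((t : ℝ) : ℂ), hΩmem t⟩
      continuous_toFun := by
        refine Continuous.subtype_mk ?_ _
        fun_prop
      source' := Subtype.ext (by simp)
      target' := Subtype.ext (by simp [basicPeriod, add_comm]) }
  have hΩ : ∀ t, expCover C a (Ω t) = L.circle t := fun t => Subtype.ext (by
    simp only [expCover_apply_coe, Ω, Path.coe_mk_mk, PlanarLasso.coe_circle_apply, circlePt,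
      Complex.exp_add, hexp])
  -- the lift of the reversed leash: the translate by `2πi` of the reversed lift
  let Λ' : Path (basicPeriod +ᵥ w₁) (basicPeriod +ᵥ w₀) :=
    Λ.symm.map (continuous_const_vadd basicPeriod)
  have hper : ∀ w : ExpRegion C a, expCover C a (basicPeriod +ᵥ w) = expCover C a w := fun w =>
    Subtype.ext (by rw [expCover_apply_coe, expCover_apply_coe, coe_vadd_expRegion,
      Complex.exp_add, exp_eq_one_of_mem_periods basicPeriod.2, one_mul])
  have hΛ' : ∀ t, expCover C a (Λ' t) = L.leash.symm t := fun t => by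
    change expCover C a (basicPeriod +ᵥ Λ (σ t)) = L.leash (σ t)
    rw [hper, hΛ]
  -- the whole lift
  let Γ : Path w₀ (basicPeriod +ᵥ w₀) := (Λ.trans Ω).trans Λ'
  have hΓ : ∀ t, expCover C a (Γ t) = L.loop t := fun t => by
    change ((Λ.trans Ω).trans Λ').map continuous_expCover t =
      ((L.leash.trans L.circle).trans L.leash.symm) t
    rw [Path.map_trans, Path.map_trans]
    exact PlanarLasso.trans_apply_congr _ _ _ _
      (PlanarLasso.trans_apply_congr _ _ _ _ hΛ hΩ) hΛ' t
  let ey : expCover C a ⁻¹' {x} := ⟨basicPeriod +ᵥ w₀, by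
    rw [Set.mem_preimage, hper, hw₀]; rfl⟩
  have hmono : cov.monodromy (L.loopClass : Path.Homotopic.Quotient x x) e = ey := by
    refine cov.monodromy_eq_of_map_eq (Γ := Path.Homotopic.Quotient.mk Γ) ?_
    rw [PlanarLasso.loopClass, ← Path.Homotopic.Quotient.mk_map, ← Path.Homotopic.Quotient.mk_cast]
    congr 1
    ext t
    exact congrArg Subtype.val (hΓ t)
  set φ := hp.fundamentalGroupToMulOpposite e with hφ
  have key : φ L.loopClass = MulOpposite.op (Multiplicative.ofAdd basicPeriod) := by
    rw [hφ, hp.fundamentalGroupToMulOpposite_apply_eq_Iff]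
    change basicPeriod +ᵥ w₀ = _
    rw [show hp.isCoveringMap = cov from rfl, hmono]
  -- conclusion: `φ` is injective and its image is generated by `φ [L]`
  rw [eq_top_iff]
  rintro γ -
  have hγ : φ γ ∈ Subgroup.zpowers (MulOpposite.op (Multiplicative.ofAdd basicPeriod)) := by
    rw [zpowers_op_ofAdd_basicPeriod_eq_top]; trivial
  rw [← key, ← MonoidHom.map_zpowers] at hγ
  obtain ⟨δ, hδ, hφδ⟩ := hγ
  rw [← hp.fundamentalGroupToMulOpposite_injective e hφδ]
  exact hδ

end OnePuncture

end PlanarLasso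

/-! ### Existence of lassos -/

section Existence

/-- **Every puncture carries a lasso at every base point**: a small closed disc about `a ∈ F`
inside `C` missing the other (finitely many) punctures, and a leash supplied by the path
connectedness of `C ∖ F` (`isPathConnected_convex_diff_finite`).
[cite: HatcherAT2002, §1.2 Example 1.21 ff. (loops around the punctures)] -/
theorem exists_planarLasso {C : Set ℂ} (hC : Convex ℝ C) (hCo : IsOpen C) {F : Set ℂ}
    (hF : F.Finite) (hFC : F ⊆ C) (x : ↥(C \ F)) {a : ℂ} (ha : a ∈ F) :
    Nonempty (PlanarLasso (C \ F) x a) := by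
  obtain ⟨r, hr, hrC⟩ := Metric.isOpen_iff.1 hCo a (hFC ha)
  have hopen : IsOpen (F \ {a})ᶜ := (hF.subset Set.sdiff_subset).isClosed.isOpen_compl
  obtain ⟨r', hr', hr'F⟩ := Metric.isOpen_iff.1 hopen a (by simp)
  set ε : ℝ := min r r' / 2 with hε_def
  have hε : 0 < ε := by rw [hε_def]; positivity
  have hεr : ε < r := by
    rw [hε_def]; linarith [min_le_left r r']
  have hεr' : ε < r' := by
    rw [hε_def]; linarith [min_le_right r r']
  have hmem : ∀ c : ℂ, c ≠ 0 → ‖c‖ ≤ ε → a + c ∈ C \ F := by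
    intro c hc hle
    refine ⟨hrC ?_, fun haF => ?_⟩
    · rw [Metric.mem_ball, dist_eq_norm, add_sub_cancel_left]; linarith
    · have h1 : a + c ∈ (F \ {a})ᶜ := hr'F (by
        rw [Metric.mem_ball, dist_eq_norm, add_sub_cancel_left]; linarith)
      exact h1 ⟨haF, fun h => hc (by simpa using h)⟩
  have hend : a + (ε : ℂ) ∈ C \ F :=
    hmem _ (by exact_mod_cast hε.ne') (by simp [abs_of_pos hε])
  haveI := pathConnectedSpace_convex_diff_finite hC hCo hF x
  exact ⟨{ ε := ε, ε_pos := hε, mem := hmem, leashEnd_mem := hend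
           leash := PathConnectedSpace.somePath x ⟨a + (ε : ℂ), hend⟩ }⟩

end Existence

/-! ### Generation by lassos -/

section Generation

/-- The set of the classes in `π₁(Y, x)` of ALL lassos of `Y` around the points of `F` (all
centres `a ∈ F`, all radii, all leashes). [folklore] -/
def lassoClasses (Y : Set ℂ) (F : Set ℂ) (x : Y) : Set (_root_.FundamentalGroup Y x) :=
  {g | ∃ a ∈ F, ∃ L : PlanarLasso Y x a, g = L.loopClass}

/-- The image of a normal closure under a homomorphism lies in the normal closure of the image
(conjugates go to conjugates). [folklore] -/
private theorem map_normalClosure_le {G H : Type*} [Group G] [Group H] (f : G →* H) (s : Set G) :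
    (Subgroup.normalClosure s).map f ≤ Subgroup.normalClosure (f '' s) := by
  rw [Subgroup.map_le_iff_le_comap]
  exact Subgroup.normalClosure_le_normal fun g hg =>
    Subgroup.subset_normalClosure (Set.mem_image_of_mem f hg)

/-- A conjugate of an element of a normal subgroup lies in it (`IsConj` form). [folklore] -/
private theorem mem_of_isConj_of_mem {G : Type*} [Group G] {N : Subgroup G} [hN : N.Normal] {g h : G}
    (hc : IsConj g h) (hh : h ∈ N) : g ∈ N := by
  obtain ⟨c, hc⟩ := isConj_iff.1 hc
  have := hN.conj_mem h hh c⁻¹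
  rwa [← hc, inv_inv, ← mul_assoc, ← mul_assoc, inv_mul_cancel, one_mul, mul_assoc,
    inv_mul_cancel, mul_one] at this

variable {C : Set ℂ} {F : Set ℂ}

/-- **The piece lemma of the induction.** Let `H ⊆ ℂ`, `C₁ = C ∩ H`, `F₁ = F ∩ H`, and
`U = {y ∈ C ∖ F | y ∈ H}`; if the lasso classes of `C₁ ∖ F₁` normally generate
`π₁(C₁ ∖ F₁, x₁)`, then the image of `π₁(U, x₁) → π₁(C ∖ F, x₁)` lies in the normal closure of the
lasso classes of `C ∖ F` (a loop in `U` is a loop in `C₁ ∖ F₁`; push its expression in lassos of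
`C₁ ∖ F₁` forward along the inclusion `C₁ ∖ F₁ ⊆ C ∖ F`, `PlanarLasso.mapOfEq_loopClass`).
[cite: HatcherAT2002, §1.2 Lemma 1.15 (use)] -/
theorem range_inclHom_le_normalClosure (H : Set ℂ) {x₁ : ℂ} (hx₁ : x₁ ∈ C \ F) (hx₁H : x₁ ∈ H)
    (ih : Subgroup.normalClosure (lassoClasses ((C ∩ H) \ (F ∩ H)) (F ∩ H)
      ⟨x₁, ⟨hx₁.1, hx₁H⟩, fun h => hx₁.2 h.1⟩) = ⊤) :
    (VanKampen.inclHom {y : ↥(C \ F) | (y : ℂ) ∈ H} (⟨x₁, hx₁⟩ : ↥(C \ F)) hx₁H).range ≤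
      Subgroup.normalClosure (lassoClasses (C \ F) F ⟨x₁, hx₁⟩) := by
  have hsub : (C ∩ H) \ (F ∩ H) ⊆ C \ F := fun z hz => ⟨hz.1.1, fun hzF => hz.2 ⟨hzF, hz.1.2⟩⟩
  let ψ : C(↥((C ∩ H) \ (F ∩ H)), ↥(C \ F)) := ⟨Set.inclusion hsub, continuous_inclusion hsub⟩
  rintro _ ⟨c, rfl⟩
  induction c using VanKampen.PushoutData.ind_fromPath with
  | h δ =>
    rw [VanKampen.inclHom_fromPath]
    -- the loop, read in the piece `C₁ ∖ F₁`
    let δ' : Path (⟨x₁, ⟨hx₁.1, hx₁H⟩, fun h => hx₁.2 h.1⟩ : ↥((C ∩ H) \ (F ∩ H)))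
        ⟨x₁, ⟨hx₁.1, hx₁H⟩, fun h => hx₁.2 h.1⟩ :=
      { toFun := fun t => ⟨((δ t : ↥(C \ F)) : ℂ),
          ⟨(δ t : ↥(C \ F)).2.1, (δ t).2⟩, fun h => (δ t : ↥(C \ F)).2.2 h.1⟩
        continuous_toFun := (continuous_subtype_val.comp
          (continuous_subtype_val.comp δ.continuous)).subtype_mk _
        source' := Subtype.ext (by
          have h := congrArg (fun y : ↥({y : ↥(C \ F) | (y : ℂ) ∈ H}) => ((y : ↥(C \ F)) : ℂ))
            δ.source
          simpa using h)
        target' := Subtype.ext (by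
          have h := congrArg (fun y : ↥({y : ↥(C \ F) | (y : ℂ) ∈ H}) => ((y : ↥(C \ F)) : ℂ))
            δ.target
          simpa using h) }
    have hδ : FundamentalGroup.fromPath (Path.Homotopic.Quotient.mk (δ.map continuous_subtype_val)) =
        FundamentalGroup.mapOfEq ψ rfl (FundamentalGroup.fromPath (Path.Homotopic.Quotient.mk δ')) := by
      rw [FundamentalGroup.mapOfEq_apply]
      change FundamentalGroup.fromPath (Path.Homotopic.Quotient.mk _) =
        FundamentalGroup.fromPath (Path.Homotopic.Quotient.mk _)
      congr 2
    rw [hδ]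
    have hmem : FundamentalGroup.fromPath (Path.Homotopic.Quotient.mk δ') ∈
        Subgroup.normalClosure (lassoClasses ((C ∩ H) \ (F ∩ H)) (F ∩ H)
          ⟨x₁, ⟨hx₁.1, hx₁H⟩, fun h => hx₁.2 h.1⟩) := by
      rw [ih]; trivial
    refine (Subgroup.normalClosure_mono ?_)
      (map_normalClosure_le _ _ (Subgroup.mem_map_of_mem _ hmem))
    rintro _ ⟨_, ⟨a, haF, L, rfl⟩, rfl⟩
    exact ⟨a, haF.1, L.incl hsub, L.mapOfEq_loopClass hsub⟩

/-- **The induction step** (`|F| ≥ 2`), for the base point at the middle of a puncture-free strip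
separating the punctures: van Kampen generation (`VanKampen.closure_range_inclHom_union_eq_top`)
for the cover of `C ∖ F` by the two open pieces cut out by the strip, and the piece lemma on both
sides. [cite: HatcherAT2002, §1.2 Lemma 1.15 and Example 1.21 ff. (method)] -/
theorem normalClosure_lassoClasses_eq_top_step (hC : Convex ℝ C) (hCo : IsOpen C)
    (hF : F.Finite) (hFC : F ⊆ C) (h2 : 2 ≤ F.ncard)
    (ih : ∀ (C' : Set ℂ), Convex ℝ C' → IsOpen C' → ∀ (F' : Set ℂ), F'.Finite → F' ⊆ C' →
      F'.ncard < F.ncard → ∀ x' : ↥(C' \ F'),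
        Subgroup.normalClosure (lassoClasses (C' \ F') F' x') = ⊤) :
    ∃ x₁ : ↥(C \ F), Subgroup.normalClosure (lassoClasses (C \ F) F x₁) = ⊤ := by
  classical
  -- a functional injective on `F`, its two smallest values `m₁ < m₂` on `F`
  obtain ⟨ℓ, hℓ⟩ := exists_clm_injOn hF
  set V : Finset ℝ := hF.toFinset.image ℓ with hV
  have hVcard : V.card = F.ncard := by
    rw [hV, Finset.card_image_of_injOn (by rw [hF.coe_toFinset]; exact hℓ),
      ← Set.ncard_eq_toFinset_card F hF]
  obtain ⟨m₁, m₂, hm₁, hm₂, hlt, hmin⟩ := exists_two_smallest V (by omega)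
  obtain ⟨a₁, ha₁F, ha₁⟩ : ∃ a₁ ∈ F, ℓ a₁ = m₁ := by
    obtain ⟨a, ha, h⟩ := Finset.mem_image.1 hm₁
    exact ⟨a, hF.mem_toFinset.1 ha, h⟩
  obtain ⟨a₂, ha₂F, ha₂⟩ : ∃ a₂ ∈ F, ℓ a₂ = m₂ := by
    obtain ⟨a, ha, h⟩ := Finset.mem_image.1 hm₂
    exact ⟨a, hF.mem_toFinset.1 ha, h⟩
  have hvals : ∀ z ∈ F, ℓ z = m₁ ∨ m₂ ≤ ℓ z := fun z hz =>
    hmin (ℓ z) (Finset.mem_image_of_mem ℓ (hF.mem_toFinset.2 hz))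
  -- the strip `c - ε < ℓ < c + ε` contains no puncture
  set c : ℝ := (m₁ + m₂) / 2 with hc
  set ε : ℝ := (m₂ - m₁) / 4 with hε_def
  have hε : 0 < ε := by rw [hε_def]; linarith
  have hnot : ∀ z ∈ F, ¬ (ℓ z < c + ε ∧ c - ε < ℓ z) := by
    rintro z hz ⟨h₁, h₂⟩
    rcases hvals z hz with h' | h'
    · rw [hc, hε_def, h'] at h₂; linarith
    · rw [hc, hε_def] at h₁; linarith
  -- the base point: the midpoint of `a₁ a₂`, inside the strip
  set x₁ : ℂ := (2⁻¹ : ℝ) • a₁ + (2⁻¹ : ℝ) • a₂ with hx₁_def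
  have hx₁C : x₁ ∈ C := hC (hFC ha₁F) (hFC ha₂F) (by norm_num) (by norm_num) (by norm_num)
  have hℓx₁ : ℓ x₁ = c := by
    rw [hx₁_def, map_add, map_smul, map_smul, ha₁, ha₂, hc, smul_eq_mul, smul_eq_mul]
    ring
  have hx₁strip : ℓ x₁ < c + ε ∧ c - ε < ℓ x₁ := by rw [hℓx₁]; constructor <;> linarith
  have hx₁F : x₁ ∉ F := fun h => hnot x₁ h hx₁strip
  have hx₁ : x₁ ∈ C \ F := ⟨hx₁C, hx₁F⟩
  -- the two open pieces
  let H₁ : Set ℂ := {z | ℓ z < c + ε}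
  let H₂ : Set ℂ := {z | c - ε < ℓ z}
  have hH₁c : Convex ℝ H₁ := convex_halfSpace_lt (ℓ : ℂ →ₗ[ℝ] ℝ).isLinear (c + ε)
  have hH₂c : Convex ℝ H₂ := convex_halfSpace_gt (ℓ : ℂ →ₗ[ℝ] ℝ).isLinear (c - ε)
  have hH₁o : IsOpen H₁ := isOpen_lt ℓ.continuous continuous_const
  have hH₂o : IsOpen H₂ := isOpen_lt continuous_const ℓ.continuous
  let U : Set ↥(C \ F) := {y | (y : ℂ) ∈ H₁}
  let T : Set ↥(C \ F) := {y | (y : ℂ) ∈ H₂}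
  have hUo : IsOpen U := hH₁o.preimage continuous_subtype_val
  have hTo : IsOpen T := hH₂o.preimage continuous_subtype_val
  have hcov : U ∪ T = univ := by
    refine eq_univ_of_forall fun y => ?_
    by_cases h : ℓ y < c + ε
    · exact Or.inl h
    · refine Or.inr ?_
      change c - ε < ℓ y
      linarith [not_lt.1 h]
  have hxU : (⟨x₁, hx₁⟩ : ↥(C \ F)) ∈ U := hx₁strip.1
  have hxT : (⟨x₁, hx₁⟩ : ↥(C \ F)) ∈ T := hx₁strip.2
  have hval : ∀ H : Set ℂ, Subtype.val '' {y : ↥(C \ F) | (y : ℂ) ∈ H} = (C ∩ H) \ (F ∩ H) := by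
    intro H
    ext z
    simp only [mem_image, Subtype.exists, mem_sdiff, exists_and_right, exists_eq_right,
      mem_inter_iff, mem_setOf_eq]
    tauto
  have hvalUT : Subtype.val '' (U ∩ T) = C ∩ (H₁ ∩ H₂) := by
    apply Set.ext
    intro z
    constructor
    · rintro ⟨y, ⟨hyU, hyT⟩, rfl⟩
      exact ⟨y.2.1, hyU, hyT⟩
    · rintro ⟨hzC, h₁, h₂⟩
      exact ⟨⟨z, hzC, fun hzF => hnot z hzF ⟨h₁, h₂⟩⟩, ⟨h₁, h₂⟩, rfl⟩
  have hpc : ∀ H : Set ℂ, Convex ℝ H → IsOpen H → x₁ ∈ H →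
      IsPathConnected {y : ↥(C \ F) | (y : ℂ) ∈ H} := by
    intro H hHc hHo hxH
    rw [IsInducing.subtypeVal.isPathConnected_iff, hval H]
    exact isPathConnected_convex_diff_finite (hC.inter hHc) (hCo.inter hHo) (hF.inter_of_left _)
      ⟨x₁, ⟨hx₁C, hxH⟩, fun h => hx₁F h.1⟩
  have hmeet : IsPathConnected (U ∩ T) := by
    rw [IsInducing.subtypeVal.isPathConnected_iff, hvalUT]
    exact (hC.inter (hH₁c.inter hH₂c)).isPathConnected ⟨x₁, hx₁C, hx₁strip.1, hx₁strip.2⟩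
  -- Seifert–van Kampen, generation half
  have hgen := VanKampen.closure_range_inclHom_union_eq_top hUo hTo hcov hxU hxT
    (hpc H₁ hH₁c hH₁o hx₁strip.1) (hpc H₂ hH₂c hH₂o hx₁strip.2) hmeet
  -- the induction hypothesis on the two pieces
  have ha₂H₁ : a₂ ∉ H₁ := by
    change ¬ ℓ a₂ < c + ε
    rw [ha₂, hc, hε_def]; intro h; linarith
  have ha₁H₂ : a₁ ∉ H₂ := by
    change ¬ c - ε < ℓ a₁
    rw [ha₁, hc, hε_def]; intro h; linarith
  have hlt : ∀ (H : Set ℂ) (b : ℂ), b ∈ F → b ∉ H → (F ∩ H).ncard < F.ncard :=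
    fun H b hbF hbH =>
    Set.ncard_lt_ncard (ssubset_of_subset_not_subset inter_subset_left fun h => hbH (h hbF).2) hF
  have ih₁ := ih (C ∩ H₁) (hC.inter hH₁c) (hCo.inter hH₁o) (F ∩ H₁) (hF.inter_of_left _)
    (inter_subset_inter_left _ hFC) (hlt H₁ a₂ ha₂F ha₂H₁)
    ⟨x₁, ⟨hx₁C, hx₁strip.1⟩, fun h => hx₁F h.1⟩
  have ih₂ := ih (C ∩ H₂) (hC.inter hH₂c) (hCo.inter hH₂o) (F ∩ H₂) (hF.inter_of_left _)
    (inter_subset_inter_left _ hFC) (hlt H₂ a₁ ha₁F ha₁H₂)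
    ⟨x₁, ⟨hx₁C, hx₁strip.2⟩, fun h => hx₁F h.1⟩
  refine ⟨⟨x₁, hx₁⟩, ?_⟩
  rw [eq_top_iff, ← hgen, Subgroup.closure_le]
  exact Set.union_subset (range_inclHom_le_normalClosure H₁ hx₁ hx₁strip.1 ih₁)
    (range_inclHom_le_normalClosure H₂ hx₁ hx₁strip.2 ih₂)

/-- **Change of base point**: if the lasso classes normally generate `π₁(C ∖ F, x₁)` then they
normally generate `π₁(C ∖ F, x)` for every `x` (transport along a path `x ⇝ x₁` prepends the path
to the leashes, `PlanarLasso.pathConj_loopClass`). [cite: HatcherAT2002, §1.1 Prop. 1.5] -/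
theorem normalClosure_lassoClasses_eq_top_of_eq_top (hC : Convex ℝ C) (hCo : IsOpen C)
    (hF : F.Finite) {x₁ : ↥(C \ F)}
    (h : Subgroup.normalClosure (lassoClasses (C \ F) F x₁) = ⊤) (x : ↥(C \ F)) :
    Subgroup.normalClosure (lassoClasses (C \ F) F x) = ⊤ := by
  haveI := pathConnectedSpace_convex_diff_finite hC hCo hF x
  let p : Path x x₁ := PathConnectedSpace.somePath x x₁
  let e := (FundamentalGroup.fundamentalGroupMulEquivOfPath p).symm
  have himage : e '' lassoClasses (C \ F) F x₁ ⊆ lassoClasses (C \ F) F x := by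
    rintro _ ⟨_, ⟨a, haF, L, rfl⟩, rfl⟩
    exact ⟨a, haF, L.precomp p, L.pathConj_loopClass p⟩
  rw [eq_top_iff]
  calc (⊤ : Subgroup (_root_.FundamentalGroup (↥(C \ F)) x))
      = (⊤ : Subgroup (_root_.FundamentalGroup (↥(C \ F)) x₁)).map e.toMonoidHom := by
        rw [← MonoidHom.range_eq_map]; exact (MonoidHom.range_eq_top.2 e.surjective).symm
    _ = (Subgroup.normalClosure (lassoClasses (C \ F) F x₁)).map e.toMonoidHom := by rw [h]
    _ = Subgroup.normalClosure (e '' lassoClasses (C \ F) F x₁) :=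
        Subgroup.map_normalClosure _ _ e.surjective
    _ ≤ Subgroup.normalClosure (lassoClasses (C \ F) F x) := Subgroup.normalClosure_mono himage

/-- **The fundamental group of a punctured convex planar domain is normally generated by the
lassos around the punctures.** For `C ⊆ ℂ` convex open, `F ⊆ C` finite and `x ∈ C ∖ F`, the
normal closure in `π₁(C ∖ F, x)` of the classes of all lassos around the points of `F` is the
whole group (Hatcher, §1.2: the plane minus `n` points has `π₁` free on loops going once around
the punctures; here the generation statement, with explicit loops, by induction on `|F|`:
no puncture — `C` is convex, hence simply connected; one puncture — the exponential covering;
`|F| ≥ 2` — van Kampen generation for a splitting by a puncture-free strip).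
[cite: HatcherAT2002, §1.2 Lemma 1.15, Thm. 1.20 and Example 1.21 ff.] -/
theorem normalClosure_lassoClasses_eq_top (hC : Convex ℝ C) (hCo : IsOpen C) (hF : F.Finite)
    (hFC : F ⊆ C) (x : ↥(C \ F)) : Subgroup.normalClosure (lassoClasses (C \ F) F x) = ⊤ := by
  suffices key : ∀ (n : ℕ) (C : Set ℂ), Convex ℝ C → IsOpen C → ∀ F : Set ℂ, F.Finite →
      F ⊆ C → F.ncard = n → ∀ x : ↥(C \ F),
        Subgroup.normalClosure (lassoClasses (C \ F) F x) = ⊤ from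
    key _ C hC hCo F hF hFC rfl x
  intro n
  induction n using Nat.strong_induction_on with
  | _ n ihn =>
    intro C hC hCo F hF hFC hn x
    rcases Nat.lt_or_ge n 2 with hn2 | hn2
    · interval_cases n
      · -- no puncture: `C` is convex, hence simply connected
        obtain rfl : F = ∅ := (Set.ncard_eq_zero hF).1 hn
        haveI : ContractibleSpace ↥(C \ (∅ : Set ℂ)) := by
          rw [sdiff_empty]
          exact hC.contractibleSpace ⟨x, by simpa using x.2⟩
        rw [eq_top_iff]
        rintro g -
        rw [Subsingleton.elim g 1]
        exact one_mem _
      · -- one puncture: the exponential covering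
        obtain ⟨a, rfl⟩ := Set.ncard_eq_one.1 hn
        have ha : a ∈ C := hFC rfl
        obtain ⟨L⟩ := exists_planarLasso hC hCo hF hFC x (rfl : a ∈ ({a} : Set ℂ))
        rw [eq_top_iff, ← PlanarLasso.zpowers_loopClass_eq_top hC hCo ha L, Subgroup.zpowers_le]
        exact Subgroup.subset_normalClosure ⟨a, rfl, L, rfl⟩
    · obtain ⟨x₁, hx₁⟩ := normalClosure_lassoClasses_eq_top_step hC hCo hF hFC (hn ▸ hn2)
        (fun C' hC' hC'o F' hF' hF'C hlt x' => ihn _ (hn ▸ hlt) C' hC' hC'o F' hF' hF'C rfl x')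
      exact normalClosure_lassoClasses_eq_top_of_eq_top hC hCo hF hx₁ x

/-- **One lasso per puncture normally generates.** For `C ⊆ ℂ` convex open, `F ⊆ C` finite,
`x ∈ C ∖ F` and ANY choice of one lasso `L a` around each `a ∈ F`, based at `x`, the normal
closure of `{[L a] | a ∈ F}` is `π₁(C ∖ F, x)` (every other lasso around `a` is conjugate to
`L a`, `PlanarLasso.isConj_loopClass`). [cite: HatcherAT2002, §1.2 Example 1.21 ff.]
[cite: Shimada2010ZvK, §3 Prop. 3.4 (planar case)] -/
theorem normalClosure_eq_top_of_lassos (hC : Convex ℝ C) (hCo : IsOpen C) (hF : F.Finite)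
    (hFC : F ⊆ C) (x : ↥(C \ F)) (L : ∀ a ∈ F, PlanarLasso (C \ F) x a) :
    Subgroup.normalClosure {g | ∃ (a : ℂ) (ha : a ∈ F), g = (L a ha).loopClass} = ⊤ := by
  rw [eq_top_iff, ← normalClosure_lassoClasses_eq_top hC hCo hF hFC x]
  refine Subgroup.normalClosure_le_normal ?_
  rintro _ ⟨a, haF, L', rfl⟩
  exact mem_of_isConj_of_mem (L'.isConj_loopClass (L a haF))
    (Subgroup.subset_normalClosure ⟨a, haF, rfl⟩)

/-- The plane itself: for `F ⊂ ℂ` finite and one lasso per puncture, the normal closure of their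
classes is `π₁(ℂ ∖ F, x)`. [cite: HatcherAT2002, §1.2 Example 1.21 ff.] -/
theorem normalClosure_eq_top_of_lassos_univ {F : Set ℂ} (hF : F.Finite) (x : ↥(Set.univ \ F))
    (L : ∀ a ∈ F, PlanarLasso (Set.univ \ F) x a) :
    Subgroup.normalClosure {g | ∃ (a : ℂ) (ha : a ∈ F), g = (L a ha).loopClass} = ⊤ :=
  normalClosure_eq_top_of_lassos convex_univ isOpen_univ hF (subset_univ F) x L

end Generation

end Literature.AlgebraicTopology.FundamentalGroup
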